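import Literature.NumberTheory.EllipticCurves.Sprung2024.ChromaticLocalInjectivity
import Literature.NumberTheory.EllipticCurves.Sprung2012.SharpFlatSelmerDualExistsProofs
import Literature.NumberTheory.EllipticCurves.IwasawaEulerCharDualityProofs
import HarnessLib

/-!
# Sprung 2024, §5.2 Lemma 5.5: the order of the `Γ`-coinvariants of the chromatic Selmer group,
# `1/|(Sel⋆(E,ℚ_∞))_Γ| = (∏_{l bad} c_l^{(p)} / #E(ℚ)_p) × 1/|ker g|` — ONE printed statement (and its
# all-conductor form, as attributed by Ray–Sprung 2025) as named facts

Topic `Literature/NumberTheory/EllipticCurves`, cluster `Sprung2024`. Companion of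
`Sprung2024/ChromaticCharValueRankZero[AllN].lean` (the named facts
`lem59[AllN]_sharpFlatCharValue_rankZero` = §5.2 Lemmas 5.5 · 5.8 · 5.9 MULTIPLIED) and of the proof
file `Sprung2024/ChromaticEulerCharAssemblyProofs.lean` (cell `bsd-ssimc`, seat
`bsd-ssimc-k3c5-kdot-split` g7), which PROVES Lemmas 5.8 and 5.9 in the kernel for the tree's
chromatic objects (`Sprung2012/SharpFlatSelmer.lean`). What that proof file does not supply is
exactly Lemma 5.5; this file vendors it ALONE, so that `lem59[AllN]` become kernel theorems modulo a
strictly smaller printed statement (composition in `Sprung2024/ChromaticCharValueRankZeroProofs.lean`).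
TWO statements as NAMED FACTS (`def … : Prop`, nothing asserted, no `_holds`; D-0014): the printed
§5.2 form (square-free conductor) and the all-conductor form (the edge between them,
`lem55_sharpFlat_coinvariants_card_of_allN`, is proved in the composition file); net debt +2.
HONEST FRAMING: nothing about any curve is asserted; no census cell moves; BSD is not proved by any
of this.

## The printed statement, verbatim (F. Ito Sprung, Adv. Math. **449** (2024) 109741 [Sprung2024],
## §5.2 p. 40; = arXiv:1610.10017 §4 Lemma 4.5, p. 15)

Setting (p. 39–40): "`𝒢⋆(ℚ_n) = im( H¹(ℚ_n, E[p^∞]) ⟶ H¹(ℚ_{n,p}, E[p^∞])/E⋆_{n,p} ×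
∏_{v ≠ p} H¹(ℚ_{n,v}, E[p^∞])/E(ℚ_{n,v}) ⊗ ℚ_p/ℤ_p )` for `n = 0` or `n = ∞`. We denote
`Gal(ℚ_∞/ℚ)` by `Γ`. We then have a commutative diagram with exact sequences with right vertical map
`g`: `0 → Sel(E,ℚ)_p → H¹(ℚ, E[p^∞]) → 𝒢⋆(ℚ) → 0` over
`0 → Sel⋆(E,ℚ_∞)_p^Γ → H¹(ℚ_∞, E[p^∞])^Γ → 𝒢⋆(ℚ_∞)^Γ`" (with "`E⋆_{0,p} = E(ℚ_p) ⊗ ℚ_p/ℤ_p`",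
p. 39). **Lemma 5.5.** "Denote by `E(ℚ)_p` the `p`-primary torsion points of `E(ℚ)`. Also denote by
`c_l^{(p)}` the `p`-component of the Tamagawa number `c_l` … Assume `(Sel⋆(E, ℚ_∞))_{Gal(ℚ_∞/ℚ)}` is
finite. We then have
`1/|(Sel⋆(E, ℚ_∞))_{Gal(ℚ_∞/ℚ)}| = (∏_{l bad} c_l^{(p)} / #E(ℚ)_p) × 1/|ker g|`." Proof (p. 40):
"The lemma with the Tamagawa factors '`∏_{l bad} c_l^{(p)}`' replaced with '`|ker(r)|`' follows from
the proof of [18, Lemma 4.7], again with '`Sel`' replaced with '`Sel⋆`'. Thus, it remains to prove that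
`|ker(r)| = ∏_{l bad} c_l^{(p)}`, which we do prime by prime … If `v ≠ p` is a good reduction prime,
we know that `ker(r_v)` is trivial by [17, Lemma 3.3]. If `v = l` is a bad reduction prime, the
discussion after [17, Lemma 3.3] shows that `|ker(r_l)| = c_l^{(p)}`. It thus remains to treat the case
`v = p` … we see that `r_p` is injective, as claimed." ([17] = Greenberg, LNM 1716; [18] = Greenberg,
PSPM 55.) The standing hypotheses of §5.2 are those of Thm. 5.3 (p. 38): square-free conductor,
supersingular reduction at `p ≠ 2`, `L(E,1) ≠ 0` (Conjecture 3.33 enters only the main-conjecture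
step of "Proof of Theorem 5.3", not Lemmas 5.5–5.9 — line check of
`ChromaticCharValueRankZeroAllN.lean`).

## Transcription (the tree's rendering of Greenberg's control diagram, `IwasawaSelmerControl*`)

* `ker g`: `g` lives on `𝒢⋆(ℚ) ≅ H¹(ℚ, E[p^∞]) / Sel(E,ℚ)_p` and a class `y mod Sel` dies under `g`
  iff its restriction `h_0 y ∈ H¹(ℚ_∞, E[p^∞])` satisfies the ⋆-Selmer conditions, so — EXACTLY as the
  tree renders Greenberg's `ker g_n` as `A_n / Sel_n` (`WeierstrassCurve.KerG`,
  `IwasawaSelmerControlExactCountProofs`: "`ker g_n` IS `A_n / Sel_n`") — `ker g = A⋆_0 / Sel_0` with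
  `A⋆_0 = h_0⁻¹(Sel⋆(E/ℚ_∞)) = (sharpFlatSelmerInfty …).comap (W.layerToInfty κ 0)` and
  `Sel_0 = W.selmerLayer κ 0` (`= Sel_{p^∞}(E/ℚ)`), written as the quotient type
  `↥A⋆_0 ⧸ (W.selmerLayer κ 0).addSubgroupOf A⋆_0`;
* `(Sel⋆(E,ℚ_∞))_Γ = Sel⋆_∞ / (γ − 1) Sel⋆_∞` for the topological generator `γ`:
  `IwasawaDual.EndCoinvariants (Sprung2012.conjSharpFlatSelmerInfty … γ − 1)` (the `S_Γ` of the tree's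
  Greenberg Lemma 4.2, `IwasawaEulerCharRankZeroProofs`);
* `#E(ℚ)_p = #E[p^∞]^{Γ_ℚ}`: `Nat.card (MulAction.fixedPoints Γ_ℚ (W.geomPrimaryTorsion p))` (the
  `|E(F)_p|` of the tree's Greenberg Lemma 4.3, `IwasawaSelmerControlKernelCardProofs`);
* `∏_{l bad} c_l^{(p)} = p^{ord_p(W.tamagawaProduct)}` (as in `lem59_…`);
* the identity of positive rationals is cleared of denominators:
  `#(A⋆_0/Sel_0) · #E(ℚ)_p = p^{ord_p ∏ c_l} · #(Sel⋆_∞)_Γ`, under the displayed hypothesis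
  "`(Sel⋆(E,ℚ_∞))_Γ` is finite"; the finiteness of `Sel_{p^∞}(E/ℚ)` (in print from `L(E,1) ≠ 0`,
  Kato; used through [17, Thm. 4.1]'s standing assumption and Cassels' theorem) is displayed as an
  extra hypothesis — a weakening, as in `lem59_…`.

Binders = those of `lem59_sharpFlatCharValue_rankZero` down to the colour (the cyclotomic / Honda
setting of `Sprung2012.thm22_exists_isHondaSystem`); the dual datum `D` does not occur (Lemma 5.5 is
a statement about `Sel⋆(E/ℚ_∞)` itself). FLAGS for the referee: `Sprung24-§5.2-via-Greenberg` (the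
proof is by reference to Greenberg's Lemmas 3.3, 4.7 with `Sel ↦ Sel⋆`; the one new ingredient, "`r_p`
is injective", is the tree's `lem55[AllN]_sharpFlat_localKerOver_of_layerToInfty_mem`, a kernel
theorem modulo Sprung 2012 Props. 7.3/7.6 by `ChromaticLocalInjectivityProofs`); for the all-conductor
form additionally `Sprung24-§5.2-allN-via-RaySprung25` (module docstring of
`ChromaticCharValueRankZeroAllN.lean`: J. Ray–F. Sprung, Ann. Inst. Fourier 75 (2025) p. 2343, "given
an analogous formula of Kim's, all assuming that `F = ℚ`, see [26, Lemmas 4.4, 4.5, 4.8]" — [26,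
Lemma 4.5] is this lemma — and the line check that square-free `N` is used only for Thm. 5.1).

## References
* [Sprung2024] §5.2: p. 39 (setting), Lemma 5.5 and its proof (p. 40), "Proof of Theorem 5.3"
  (p. 41); Thm. 5.3 (p. 38). arXiv:1610.10017 §4 Lemma 4.5 (p. 15).
* [RaySprung2025] J. Ray, F. I. Sprung, Ann. Inst. Fourier 75 (2025), p. 2343.
* [GreenbergLNM1716] R. Greenberg, LNM 1716 (1999), §3 Lemma 3.3 (pp. 86–88), §4 Lemmas 4.4–4.7
  (pp. 104–108) (Cassels' theorem `𝒫_E^Σ(F)/𝒢_E^Σ(F) ≅ E(F)_p^∨`, p. 104).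
* [Sprung2012] F. Sprung, J. Number Theory 132 (2012), Def. 7.9 / 7.11 (the objects).
-/

noncomputable section

open scoped Classical NumberField

open NumberField IsDedekindDomain WeierstrassCurve Literature.NumberTheory.EllipticCurves
  Literature.NumberTheory.EllipticCurves.ZpExtension Literature.NumberTheory.EllipticCurves.Sprung2017
  Literature.NumberTheory.EllipticCurves.Sprung2012 Literature.NumberTheory.EllipticCurves.IwasawaDual

namespace Literature.NumberTheory.EllipticCurves.Sprung2024

/-- **Sprung 2024, §5.2 Lemma 5.5 (the order of `(Sel⋆(E,ℚ_∞))_Γ`; Greenberg's Lemmas 4.4 + 4.7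
with `Sel ↦ Sel⋆`).** Printed (p. 40): "Denote by `E(ℚ)_p` the `p`-primary torsion points of `E(ℚ)`.
Also denote by `c_l^{(p)}` the `p`-component of the Tamagawa number `c_l` … Assume
`(Sel⋆(E, ℚ_∞))_{Gal(ℚ_∞/ℚ)}` is finite. We then have
`1/|(Sel⋆(E, ℚ_∞))_{Gal(ℚ_∞/ℚ)}| = (∏_{l bad} c_l^{(p)} / #E(ℚ)_p) × 1/|ker g|`", `g` the right
vertical map `𝒢⋆(ℚ) → 𝒢⋆(ℚ_∞)^Γ` of the control diagram of p. 40. Here, under §5.2's standing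
hypotheses (`N` square-free, `p ≠ 2` good supersingular i.e. `p ∣ a_p`, `L(E,1) ≠ 0`) and in the
cyclotomic / Honda setting of `Sprung2012.thm22_exists_isHondaSystem`, for either colour `⋆`, with
`Sel_{p^∞}(E/ℚ)` finite displayed (in print from `L(E,1) ≠ 0`) and the displayed assumption
"`(Sel⋆(E,ℚ_∞))_Γ` finite" (`EndCoinvariants (conj_γ − 1)`): cleared of denominators,
**`#ker g · #E(ℚ)_p = p^{ord_p(∏_l c_l)} · #(Sel⋆(E,ℚ_∞))_Γ`** with `ker g = A⋆_0 / Sel_0`,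
`A⋆_0 = h_0⁻¹(Sel⋆(E/ℚ_∞)) ⊆ H¹(ℚ, E[p^∞])` (the tree's rendering of Greenberg's `ker g`, see
`WeierstrassCurve.KerG`), `#E(ℚ)_p = #E[p^∞]^{Γ_ℚ}`. Flag `Sprung24-§5.2-via-Greenberg` (module
docstring). Nothing is asserted; no `_holds` is expected.
[cite: Sprung2024, §5.2 Lemma 5.5 (p. 40)] [cite: GreenbergLNM1716, §4 Lemmas 4.4 and 4.7 (pp. 104–108)] -/
def lem55_sharpFlat_coinvariants_card : Prop :=
  ∀ (W : WeierstrassCurve ℚ) [W.IsElliptic] [W.IsGloballyMinimal] (p : ℕ) [Fact p.Prime],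
    p ≠ 2 → W.IsSemistable (𝓞 ℚ) → W.HasGoodReductionAtPrime p → (p : ℤ) ∣ W.frobeniusTrace p →
    W.entireLFunction 1 ≠ 0 →
    ∀ (κ : ZpExtension ℚ p) (γ : Field.absoluteGaloisGroup ℚ),
      κ.IsCyclotomic → κ.IsTopGenerator γ → IsCyclotomicVariable p γ →
    ∀ (v : HeightOneSpectrum (𝓞 ℚ)), (p : 𝓞 ℚ) ∈ v.asIdeal →
    ∀ (g : Field.absoluteGaloisGroup (v.adicCompletion ℚ)),
      κ.IsTopGenerator (resGalOfEmb (closureEmb (K := ℚ) (v.adicCompletion ℚ)) g) →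
    ∀ (cneg : localPoints W (v.adicCompletion ℚ)) (c : ℕ → localPoints W (v.adicCompletion ℚ)),
      IsHondaSystem κ (closureEmb (K := ℚ) (v.adicCompletion ℚ)) W (W.frobeniusTrace p) g cneg c →
    ∀ (col : Chroma), Finite (W.selmerGroupPInfty p) →
      Finite (EndCoinvariants (conjSharpFlatSelmerInfty W κ (closureEmb (K := ℚ) (v.adicCompletion ℚ))
        (W.frobeniusTrace p) g c col γ - 1)) →
      Nat.card (↥((sharpFlatSelmerInfty W κ (closureEmb (K := ℚ) (v.adicCompletion ℚ))
            (W.frobeniusTrace p) g c col).comap (W.layerToInfty κ 0)) ⧸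
          (W.selmerLayer κ 0).addSubgroupOf
            ((sharpFlatSelmerInfty W κ (closureEmb (K := ℚ) (v.adicCompletion ℚ))
              (W.frobeniusTrace p) g c col).comap (W.layerToInfty κ 0))) *
        Nat.card (MulAction.fixedPoints (Field.absoluteGaloisGroup ℚ) (W.geomPrimaryTorsion p)) =
      p ^ (padicValNat p W.tamagawaProduct) *
        Nat.card (EndCoinvariants (conjSharpFlatSelmerInfty W κ
          (closureEmb (K := ℚ) (v.adicCompletion ℚ)) (W.frobeniusTrace p) g c col γ - 1))

/-- **Sprung 2024, §5.2 Lemma 5.5 for every conductor, as attributed by Ray–Sprung** ("the second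
author has … given an analogous formula of Kim's, all assuming that `F = ℚ`, see [26, Lemmas 4.4,
4.5, 4.8]", Ann. Inst. Fourier 75 (2025) p. 2343; [26, Lemma 4.5] = this lemma): the body of
`lem55_sharpFlat_coinvariants_card` WITHOUT the binder `W.IsSemistable (𝓞 ℚ)` and nothing else
changed — for `p ≠ 2` good supersingular (`p ∣ a_p`), `L(E,1) ≠ 0`, the cyclotomic / Honda setting,
either colour, `Sel_{p^∞}(E/ℚ)` finite and `(Sel⋆(E,ℚ_∞))_Γ` finite:
`#ker g · #E(ℚ)_p = p^{ord_p(∏_l c_l)} · #(Sel⋆(E,ℚ_∞))_Γ`, `ker g = A⋆_0/Sel_0`. STRONGER than the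
section-level statement of [Sprung2024]; flags `Sprung24-§5.2-allN-via-RaySprung25` (the refereed
attribution + the line check that square-free `N` is used only inside the proof of Thm. 5.1) and
`Sprung24-§5.2-via-Greenberg`. Nothing is asserted; no `_holds` is expected.
[cite: RaySprung2025, p. 2343 (§1.2, the sentence on Sel♯/Sel♭ and [26, Lemmas 4.4, 4.5, 4.8])]
[cite: Sprung2024, §5.2 Lemma 5.5 (p. 40)] -/
def lem55AllN_sharpFlat_coinvariants_card : Prop :=
  ∀ (W : WeierstrassCurve ℚ) [W.IsElliptic] [W.IsGloballyMinimal] (p : ℕ) [Fact p.Prime],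
    p ≠ 2 → W.HasGoodReductionAtPrime p → (p : ℤ) ∣ W.frobeniusTrace p →
    W.entireLFunction 1 ≠ 0 →
    ∀ (κ : ZpExtension ℚ p) (γ : Field.absoluteGaloisGroup ℚ),
      κ.IsCyclotomic → κ.IsTopGenerator γ → IsCyclotomicVariable p γ →
    ∀ (v : HeightOneSpectrum (𝓞 ℚ)), (p : 𝓞 ℚ) ∈ v.asIdeal →
    ∀ (g : Field.absoluteGaloisGroup (v.adicCompletion ℚ)),
      κ.IsTopGenerator (resGalOfEmb (closureEmb (K := ℚ) (v.adicCompletion ℚ)) g) →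
    ∀ (cneg : localPoints W (v.adicCompletion ℚ)) (c : ℕ → localPoints W (v.adicCompletion ℚ)),
      IsHondaSystem κ (closureEmb (K := ℚ) (v.adicCompletion ℚ)) W (W.frobeniusTrace p) g cneg c →
    ∀ (col : Chroma), Finite (W.selmerGroupPInfty p) →
      Finite (EndCoinvariants (conjSharpFlatSelmerInfty W κ (closureEmb (K := ℚ) (v.adicCompletion ℚ))
        (W.frobeniusTrace p) g c col γ - 1)) →
      Nat.card (↥((sharpFlatSelmerInfty W κ (closureEmb (K := ℚ) (v.adicCompletion ℚ))
            (W.frobeniusTrace p) g c col).comap (W.layerToInfty κ 0)) ⧸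
          (W.selmerLayer κ 0).addSubgroupOf
            ((sharpFlatSelmerInfty W κ (closureEmb (K := ℚ) (v.adicCompletion ℚ))
              (W.frobeniusTrace p) g c col).comap (W.layerToInfty κ 0))) *
        Nat.card (MulAction.fixedPoints (Field.absoluteGaloisGroup ℚ) (W.geomPrimaryTorsion p)) =
      p ^ (padicValNat p W.tamagawaProduct) *
        Nat.card (EndCoinvariants (conjSharpFlatSelmerInfty W κ
          (closureEmb (K := ℚ) (v.adicCompletion ℚ)) (W.frobeniusTrace p) g c col γ - 1))

end Literature.NumberTheory.EllipticCurves.Sprung2024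

end
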